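/-
Copyright (c) 2026 the pub-hodgecm-mathlib formalisation cell (harness21).  Prover seat hodgecm-mathlib-K2E3-p06 (g2), Track B «K2-LIT» ∕ h413,
ENGINE E3 unit U4 «Keys», SIGS-TABLE row #6 `sig_K2E3IrregularReducibleCaseThree` — analytic letter hKP, brick F4b (the two-bump test function on `E⁺`).
-/
import Summits.HodgeConjecture.HodgeConjecture.Theorems.K2E3SigmaEvenCharacter   -- ★ brick F4 (this seat): σ-even `ψ`, orthogonality on `E^±`-balls; brings ★ F2 ∕ F3
import HarnessLib

/-!
# K2 · E3 · U4 «Keys», row #6 — brick F4b: the TWO-BUMP test function `Φ(a) = ψ(−a)𝟙_B(a) − ψ(−c₀a)𝟙_B(c₀a)` on `E⁺` (`B = {‖a‖ ≤ ρ}`): its `ψ`-transform is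
# `μ⁺(B)·(𝟙[a'−1 ∈ 𝔞] − χ⁺(c₀)⁻¹ 𝟙[a'c₀⁻¹−1 ∈ 𝔞])`, `𝔞 = Ann(B)` a SMALL neighbourhood of `0`, and pairs with a multiplicative `D̄` to `μ⁺(B) μ⁺(𝔞) (1 − D̄(c₀))`
# [Tate1950 §2.5; WeilBNT1967 II §5; Keys1984 §5]

Cell `pub/hodgecm-mathlib` (D-0151), HCML Track B «K2-LIT», crux H413 = `stmt-HodgeConjecture-24833` (lane `--supports … --as helper`), route
HCCMUnconditional; socket `sig_K2E3IrregularReducibleCaseThree` (U4-c) of `Cruxes/H413/Lines/K2_E3_EllipticInputsSigs_U4Keys.lean`.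
THEOREMS ONLY (0 def ∕ 0 instance ∕ 0 notation ∕ 0 sorry); ★-only imports.  FRAME of ★ bricks F2–F4 (`E`, `σ`, `2 ∈ Eˣ`, `E^±`, regular Haar `μ⁺` of `E⁺`, a `σ`-even
additive character `ψ`), a `σ`-fixed unit `c₀` (for hKP: `χ₁(c₀) = −1`), a fixed `a₁` with `ψ(a₁) ≠ 1` (★ F4 `exists_fixed_addChar_ne_one`).
WHY.  In Tate's Fubini trick at `s = 0` (★ F1) the factor `Z(ĝ_T, χ⁻¹, 1)` must be NON-ZERO and computable; choosing the `E⁺`-profile of `g_T` as this `Φ` makes its transform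
a pair of bumps at `1` and `c₀` (no Gauss sum), against which `χ̄₁` integrates to `μ⁺(B)μ⁺(𝔞)(1 − χ̄₁(c₀)) = 2μ⁺(B)μ⁺(𝔞) ≠ 0`.
* §1 `integral_eq_fixedModulus_smul_integral_comp_smulFixed` (`∫_{E⁺} g = χ⁺(l) ∫ g(l ·)`), `measure_preimage_smulFixed` (`μ⁺(l⁻¹S) = χ⁺(l)⁻¹μ⁺(S)`);
* §2 **`integral_addChar_mul_twoBump`** — `∫_{E⁺} ψ(a a')Φ(a) dμ⁺ = μ⁺(B)(𝟙[∀ a ∈ B, ψ(a(a'−1)) = 1] − χ⁺(c₀)⁻¹ 𝟙[∀ a ∈ B, ψ(a(a'c₀⁻¹−1)) = 1])` (★ F4 orthogonality twice,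
  the second after the substitution `a = c₀⁻¹ b`); `norm_integral_addChar_mul_twoBump_le` (a bound), `twoBump_eq_zero_of_normAbs_lt` (`Φ = 0` near `0`),
  `twoBump_eq_zero_of_lt_normAbs` (`Φ = 0` off a ball), `measurable_twoBump`, `norm_twoBump_le`;
* §3 **`integral_twoBumpTransform_mul_eq`** — for `D̄` multiplicative with `D̄(1+t) = 1` on `‖t‖ ≤ r₁` and `‖a₁‖/ρ ≤ r₁ < 1`:
  `∫_{E⁺} (∫ ψ(a a')Φ(a) dμ⁺(a)) D̄(a') dμ⁺(a') = μ⁺(B) μ⁺(𝔞) (1 − D̄(c₀))`, `𝔞 = {t ∈ E⁺ : ψ(a t) = 1 ∀ a ∈ B}` (closed, of positive finite measure: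
  `measurableSet_ann`, `ann_subset_ball`, `measure_ann_pos`), and `apply_eq_of_twoBumpTransform_ne_zero` (`D̄(a' + y') = D̄(a')` for `‖y'‖` small on the support).
HONEST LABEL: HC_CM is proved only modulo the 7 printed citations (2 remaining named inputs: hLiu418 = `stmt-HodgeConjecture-24832`, h413 =
`stmt-HodgeConjecture-24833`) until rung 0 closes; count-neutral analytic plumbing (no socket paid here).

## References
* [Tate1950] J. Tate, *Fourier analysis in number fields and Hecke's zeta-functions* (1950), §2.5 (transforms of `𝟙_{1+𝔭^c}` and of `ψ · 𝟙_{𝔭^n}`: bumps).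
* [WeilBNT1967] A. Weil, *Basic Number Theory* (1967), Ch. II §5.
* [Keys1984] D. Keys, *Principal series representations of special unitary groups over local fields*, Compositio Math. 51 (1984), §5.
-/

set_option autoImplicit false
-- the mandated namespace has the single-problem summit's repeated segment (`HodgeConjecture.HodgeConjecture`)
set_option linter.dupNamespace false

noncomputable section

open scoped NNReal ENNReal Topology Pointwise
open MeasureTheory Filter Set
open Literature.NumberTheory.GaloisRepresentations.IsNonarchimedeanLocalField
open Literature.NumberTheory.Automorphic
open Literature.NumberTheory.Automorphic.UnitaryGroup.HeisRing
open Summit.HodgeConjecture.HodgeConjecture.Cruxes.H413.K2E3SkewLineIntegrable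
open Summit.HodgeConjecture.HodgeConjecture.Cruxes.H413.K2E3SkewLineZetaFibration
open Summit.HodgeConjecture.HodgeConjecture.Cruxes.H413.K2E3SigmaEvenCharacter

namespace Summit.HodgeConjecture.HodgeConjecture.Cruxes.H413.K2E3TwoBumpTransform

variable {E : Type*} [Field E] [ValuativeRel E] [TopologicalSpace E] [IsNonarchimedeanLocalField E]
  (σ : E →+* E) (hσ : ∀ x, σ (σ x) = x) (hσc : Continuous σ) [Invertible (2 : E)]
  (hσn : ∀ x, normAbs E (σ x) = normAbs E x)
  (ψ : AddChar E Circle) (hψc : Continuous ψ) (hψσ : ∀ x, ψ (σ x) = ψ x)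
  [MeasurableSpace E] [BorelSpace E] [T2Space E]
  (μp : Measure (fixedPart σ)) [μp.IsAddHaarMeasure] [μp.Regular]

/-! ## §1 The substitution `a = l b` on `E⁺` -/

section Subst

omit [Invertible (2 : E)] in
/-- **`∫_{E⁺} g(a) da = χ⁺(l) · ∫_{E⁺} g(l b) db`** for a `σ`-fixed unit `l` (★ `map_smulFixed_eq`; twin of ★ B2 (i) on `E⁻`). [cite: WeilBNT1967, Ch. I §2] -/
theorem integral_eq_fixedModulus_smul_integral_comp_smulFixed {V : Type*} [NormedAddCommGroup V] [NormedSpace ℝ V]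
    (l : Eˣ) (hl : σ (l : E) = l) (g : fixedPart σ → V) :
    ∫ a, g a ∂μp = (fixedModulus σ hσc l hl : ℝ) • ∫ b, g (smulFixed σ l hl b) ∂μp := by
  haveI := locallyCompactSpace_fixedPart σ hσc
  have hpos := fixedModulus_pos σ hσc l hl
  have h1 : ∫ b, g (smulFixed σ l hl b) ∂μp = ∫ a, g a ∂(μp.map (smulFixed σ l hl)) :=
    (MeasureTheory.integral_map_equiv (smulFixed σ l hl).toHomeomorph.toMeasurableEquiv g).symm
  rw [h1, map_smulFixed_eq σ hσc l hl μp, integral_smul_nnreal_measure, ← NNReal.smul_def, smul_smul, mul_inv_cancel₀ hpos.ne', one_smul]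

omit [Invertible (2 : E)] in
/-- **`μ⁺((l ·)⁻¹ S) = χ⁺(l)⁻¹ μ⁺(S)`** for a `σ`-fixed unit `l` and a measurable `S ⊆ E⁺`. [cite: WeilBNT1967, Ch. I §2] -/
theorem measure_preimage_smulFixed (l : Eˣ) (hl : σ (l : E) = l) {S : Set (fixedPart σ)} (hS : MeasurableSet S) :
    μp ((smulFixed σ l hl) ⁻¹' S) = ((fixedModulus σ hσc l hl)⁻¹ : ℝ≥0) * μp S := by
  haveI := locallyCompactSpace_fixedPart σ hσc
  have hms : Measurable (smulFixed σ l hl : fixedPart σ → fixedPart σ) := (smulFixed σ l hl).continuous.measurable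
  rw [← Measure.map_apply hms hS, map_smulFixed_eq σ hσc l hl μp, Measure.coe_nnreal_smul_apply]

end Subst

/-! ## §2 The transform of the two-bump function -/

section TwoBump

omit [Invertible (2 : E)] [μp.IsAddHaarMeasure] [μp.Regular] in
include hσc hψc in
/-- A ball-indicator of `a ↦ ψ(a t)` on `E⁺` is integrable (bounded by `1` on a compact ball). [folklore] -/
theorem integrable_indicator_fixedBall_addChar_mul [IsFiniteMeasureOnCompacts μp] (ρ : ℝ≥0) (t : E) :
    Integrable (fun a : fixedPart σ => {a : fixedPart σ | normAbs E (a : E) ≤ ρ}.indicator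
      (fun a : fixedPart σ => ((ψ ((a : E) * t) : Circle) : ℂ)) a) μp := by
  have hB : MeasurableSet {a : fixedPart σ | normAbs E (a : E) ≤ ρ} :=
    measurableSet_le (LocalFieldHaar.continuous_normAbs.measurable.comp measurable_subtype_coe) measurable_const
  have hBfin : μp {a : fixedPart σ | normAbs E (a : E) ≤ ρ} < ⊤ :=
    ((isClosed_fixedPart σ hσc).isClosedEmbedding_subtypeVal.isCompact_preimage (isCompact_setOf_normAbs_le ρ)).measure_lt_top
  rw [integrable_indicator_iff hB]
  have hcont : Continuous (fun a : fixedPart σ => ((ψ ((a : E) * t) : Circle) : ℂ)) :=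
    continuous_subtype_val.comp (hψc.comp ((continuous_subtype_val (p := fun x : E => x ∈ fixedPart σ)).mul continuous_const))
  exact Measure.integrableOn_of_bounded (M := 1) hBfin.ne hcont.aestronglyMeasurable (Eventually.of_forall fun a => (Circle.norm_coe _).le)

open scoped Classical in
omit [Invertible (2 : E)] in
include hσc hψc in
/-- **THE `ψ`-TRANSFORM OF `Φ(a) = ψ(−a)𝟙_B(a) − ψ(−c₀ a)𝟙_B(c₀ a)`** (`B = {‖·‖ ≤ ρ}`, `c₀` a `σ`-fixed unit): for every `a' : E`,
`∫_{E⁺} ψ(a a') Φ(a) dμ⁺(a) = μ⁺(B) · (𝟙[∀ a ∈ B, ψ(a(a'−1)) = 1] − χ⁺(c₀)⁻¹ · 𝟙[∀ a ∈ B, ψ(a(a'c₀⁻¹ − 1)) = 1])` — ★ F4 orthogonality for the first bump, and for the second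
after `a = c₀⁻¹ b` (§1): «the transform of `ψ·𝟙_{ball}` is a bump at `1`» [Tate1950 §2.5]. [cite: Tate1950, §2.5] [cite: WeilBNT1967, Ch. II §5] -/
theorem integral_addChar_mul_twoBump (ρ : ℝ≥0) (c₀ : Eˣ) (hc₀ : σ (c₀ : E) = c₀) (a' : E) :
    ∫ a : fixedPart σ, ((ψ ((a : E) * a') : Circle) : ℂ) *
        (((ψ (-(a : E)) : Circle) : ℂ) * {x : E | normAbs E x ≤ ρ}.indicator (fun _ => (1 : ℂ)) (a : E) -
          ((ψ (-((c₀ : E) * (a : E))) : Circle) : ℂ) * {x : E | normAbs E x ≤ ρ}.indicator (fun _ => (1 : ℂ)) ((c₀ : E) * (a : E))) ∂μp =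
      ((μp.real {a : fixedPart σ | normAbs E (a : E) ≤ ρ} : ℝ) : ℂ) *
        ((if (∀ a : fixedPart σ, normAbs E (a : E) ≤ ρ → ψ ((a : E) * (a' - 1)) = 1) then (1 : ℂ) else 0) -
          ((((fixedModulus σ hσc c₀ hc₀)⁻¹ : ℝ≥0) : ℝ) : ℂ) *
            (if (∀ a : fixedPart σ, normAbs E (a : E) ≤ ρ → ψ ((a : E) * (a' * (c₀ : E)⁻¹ - 1)) = 1) then (1 : ℂ) else 0)) := by
  haveI := locallyCompactSpace_fixedPart σ hσc
  have hm := fixedModulus_pos σ hσc c₀ hc₀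
  -- the two terms as indicator functions on `E⁺`
  set t₁ : fixedPart σ → ℂ := fun a => {a : fixedPart σ | normAbs E (a : E) ≤ ρ}.indicator
    (fun a : fixedPart σ => ((ψ ((a : E) * (a' - 1)) : Circle) : ℂ)) a with ht₁
  set H : fixedPart σ → ℂ := fun b => {b : fixedPart σ | normAbs E (b : E) ≤ ρ}.indicator
    (fun b : fixedPart σ => ((ψ ((b : E) * (a' * (c₀ : E)⁻¹ - 1)) : Circle) : ℂ)) b with hH
  have hpt : ∀ a : fixedPart σ, ((ψ ((a : E) * a') : Circle) : ℂ) *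
        (((ψ (-(a : E)) : Circle) : ℂ) * {x : E | normAbs E x ≤ ρ}.indicator (fun _ => (1 : ℂ)) (a : E) -
          ((ψ (-((c₀ : E) * (a : E))) : Circle) : ℂ) * {x : E | normAbs E x ≤ ρ}.indicator (fun _ => (1 : ℂ)) ((c₀ : E) * (a : E))) =
      t₁ a - H (smulFixed σ c₀ hc₀ a) := by
    intro a
    have e1 : ((ψ ((a : E) * a') : Circle) : ℂ) * ((ψ (-(a : E)) : Circle) : ℂ) = ((ψ ((a : E) * (a' - 1)) : Circle) : ℂ) := by
      rw [← Circle.coe_mul, ← AddChar.map_add_eq_mul]; congr 2; ring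
    have e2 : ((ψ ((a : E) * a') : Circle) : ℂ) * ((ψ (-((c₀ : E) * (a : E))) : Circle) : ℂ) =
        ((ψ (((c₀ : E) * (a : E)) * (a' * (c₀ : E)⁻¹ - 1)) : Circle) : ℂ) := by
      rw [← Circle.coe_mul, ← AddChar.map_add_eq_mul]; congr 2; field_simp; ring
    simp only [ht₁, hH, Set.indicator_apply, Set.mem_setOf_eq, coe_smulFixed]
    split_ifs <;> first | (rw [← e1, ← e2]; ring) | (rw [← e1]; ring) | (rw [← e2]; ring) | ring
  have ht₁i : Integrable t₁ μp := integrable_indicator_fixedBall_addChar_mul σ hσc ψ hψc μp ρ (a' - 1)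
  have hHi : Integrable H μp := integrable_indicator_fixedBall_addChar_mul σ hσc ψ hψc μp ρ (a' * (c₀ : E)⁻¹ - 1)
  have hHi' : Integrable (fun a => H (smulFixed σ c₀ hc₀ a)) μp := by
    have h := (integrable_map_equiv (smulFixed σ c₀ hc₀).toHomeomorph.toMeasurableEquiv H).1
      (by rw [show ((smulFixed σ c₀ hc₀).toHomeomorph.toMeasurableEquiv : fixedPart σ → fixedPart σ) = (smulFixed σ c₀ hc₀) from rfl,
            map_smulFixed_eq σ hσc c₀ hc₀ μp]; exact hHi.smul_measure ENNReal.coe_ne_top)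
    exact h
  -- the two integrals
  have hI₁ : ∫ a, t₁ a ∂μp = if (∀ a : fixedPart σ, normAbs E (a : E) ≤ ρ → ψ ((a : E) * (a' - 1)) = 1)
      then ((μp.real {a : fixedPart σ | normAbs E (a : E) ≤ ρ} : ℝ) : ℂ) else 0 := integral_fixedBall_addChar_mul σ ψ μp ρ (a' - 1)
  have hI₂ : ∫ a, H (smulFixed σ c₀ hc₀ a) ∂μp = ((((fixedModulus σ hσc c₀ hc₀)⁻¹ : ℝ≥0) : ℝ) : ℂ) *
      (if (∀ a : fixedPart σ, normAbs E (a : E) ≤ ρ → ψ ((a : E) * (a' * (c₀ : E)⁻¹ - 1)) = 1)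
        then ((μp.real {a : fixedPart σ | normAbs E (a : E) ≤ ρ} : ℝ) : ℂ) else 0) := by
    have h := integral_eq_fixedModulus_smul_integral_comp_smulFixed σ hσc μp c₀ hc₀ H
    rw [integral_fixedBall_addChar_mul σ ψ μp ρ (a' * (c₀ : E)⁻¹ - 1)] at h
    have hm' : ((fixedModulus σ hσc c₀ hc₀ : ℝ) : ℂ) ≠ 0 := by exact_mod_cast hm.ne'
    rw [Complex.real_smul] at h
    rw [NNReal.coe_inv, Complex.ofReal_inv, eq_inv_mul_iff_mul_eq₀ hm', ← h]
  simp_rw [hpt]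
  rw [integral_sub ht₁i hHi', hI₁, hI₂]
  split_ifs <;> ring

end TwoBump

/-! ## §3 The annihilator `𝔞` of the ball, and the pairing of the transform with a multiplicative `D̄` -/

section Pairing

omit [Invertible (2 : E)] [T2Space E] [μp.IsAddHaarMeasure] [μp.Regular] in
include hψc in
/-- `𝔞 = {t ∈ E⁺ : ψ(a t) = 1 for all a ∈ E⁺ with ‖a‖ ≤ ρ}` is closed, hence measurable. [cite: WeilBNT1967, Ch. II §5] -/
theorem measurableSet_ann (ρ : ℝ≥0) :
    MeasurableSet {t : fixedPart σ | ∀ a : fixedPart σ, normAbs E (a : E) ≤ ρ → ψ ((a : E) * (t : E)) = 1} := by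
  have h : {t : fixedPart σ | ∀ a : fixedPart σ, normAbs E (a : E) ≤ ρ → ψ ((a : E) * (t : E)) = 1} =
      ⋂ a : fixedPart σ, ⋂ (_ : normAbs E (a : E) ≤ ρ), {t : fixedPart σ | ψ ((a : E) * (t : E)) = 1} := by
    ext t; simp only [Set.mem_setOf_eq, Set.mem_iInter]
  rw [h]
  refine (isClosed_iInter fun a => isClosed_iInter fun _ => isClosed_eq ?_ continuous_const).measurableSet
  exact hψc.comp (continuous_const.mul continuous_subtype_val)

omit [Invertible (2 : E)] [MeasurableSpace E] [BorelSpace E] [T2Space E] in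
/-- **`𝔞` is small**: for a fixed `a₁` with `ψ(a₁) ≠ 1`, `𝔞 ⊆ {‖t‖ < ‖a₁‖/ρ}` (★ F4). [cite: WeilBNT1967, Ch. II §5] -/
theorem ann_subset_ball {a₁ : E} (ha₁ : σ a₁ = a₁) (hψa₁ : ψ a₁ ≠ 1) {ρ : ℝ≥0} (hρ : 0 < ρ) {t : fixedPart σ}
    (ht : ∀ a : fixedPart σ, normAbs E (a : E) ≤ ρ → ψ ((a : E) * (t : E)) = 1) : normAbs E (t : E) < normAbs E a₁ / ρ :=
  normAbs_lt_of_forall_fixed_addChar_mul_eq_one σ ψ ha₁ hψa₁ hρ t.2 fun a ha hle => ht ⟨a, ha⟩ hle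

omit [Invertible (2 : E)] [BorelSpace E] [T2Space E] [μp.Regular] in
/-- **`𝔞` has positive measure**: it contains the open ball `{‖t‖ < r_ψ/ρ}` of `E⁺` (★ F4 `addChar_mul_eq_one_of_normAbs_le`). [cite: WeilBNT1967, Ch. II §5] -/
theorem measure_ann_pos {rψ : ℝ≥0} (hrψ0 : 0 < rψ) (hrψ : ∀ z : E, normAbs E z ≤ rψ → ψ z = 1) {ρ : ℝ≥0} (hρ : 0 < ρ) :
    0 < μp {t : fixedPart σ | ∀ a : fixedPart σ, normAbs E (a : E) ≤ ρ → ψ ((a : E) * (t : E)) = 1} := by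
  have hopen : IsOpen {t : fixedPart σ | normAbs E (t : E) < rψ / ρ} :=
    isOpen_lt (LocalFieldHaar.continuous_normAbs.comp continuous_subtype_val) continuous_const
  have hne : ({t : fixedPart σ | normAbs E (t : E) < rψ / ρ}).Nonempty := ⟨0, by show normAbs E ((0 : fixedPart σ) : E) < rψ / ρ; simp [div_pos hrψ0 hρ]⟩
  refine lt_of_lt_of_le (hopen.measure_pos μp hne) (measure_mono fun t ht a ha => ?_)
  exact addChar_mul_eq_one_of_normAbs_le ψ hrψ hρ ha (le_of_lt ht)

open scoped Classical in
omit [Invertible (2 : E)] in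
include hσc hψc in
/-- **THE TRANSFORM OF `Φ` PAIRED WITH A MULTIPLICATIVE `D̄`**: if `D̄(a b) = D̄ a · D̄ b`, `‖D̄‖ ≤ C`, `D̄(1 + t) = 1` for `‖t‖ ≤ r₁`, `a₁` is fixed with `ψ(a₁) ≠ 1` and `‖a₁‖/ρ ≤ r₁`,
then `∫_{E⁺} μ⁺(B)(𝟙[a'−1 ∈ 𝔞] − χ⁺(c₀)⁻¹𝟙[a'c₀⁻¹−1 ∈ 𝔞]) D̄(a') dμ⁺(a') = μ⁺(B) · μ⁺(𝔞) · (1 − D̄(c₀))`: the first bump sits on `1 + 𝔞` where `D̄ ≡ 1`, the second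
on `c₀(1 + 𝔞)` where `D̄ ≡ D̄(c₀)`, of mass `χ⁺(c₀) μ⁺(𝔞)` cancelling the prefactor `χ⁺(c₀)⁻¹`.  For hKP: `D̄ = χ̄₁`, `D̄(c₀) = −1`, value `2μ⁺(B)μ⁺(𝔞) ≠ 0`.
[cite: Tate1950, §2.5] [cite: Keys1984, §5] -/
theorem integral_twoBumpTransform_mul_eq (ρ : ℝ≥0) (hρ : 0 < ρ) (c₀ : Eˣ) (hc₀ : σ (c₀ : E) = c₀)
    {a₁ : E} (ha₁ : σ a₁ = a₁) (hψa₁ : ψ a₁ ≠ 1) (Dbar : E → ℂ) (hDm : Measurable Dbar) {C : ℝ} (hDb : ∀ b, ‖Dbar b‖ ≤ C)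
    (hDmul : ∀ a b, Dbar (a * b) = Dbar a * Dbar b)
    {r₁ : ℝ≥0} (hD1 : ∀ t : E, normAbs E t ≤ r₁ → Dbar (1 + t) = 1) (hρr : normAbs E a₁ / ρ ≤ r₁) :
    ∫ a' : fixedPart σ, (((μp.real {a : fixedPart σ | normAbs E (a : E) ≤ ρ} : ℝ) : ℂ) *
        ((if (∀ a : fixedPart σ, normAbs E (a : E) ≤ ρ → ψ ((a : E) * ((a' : E) - 1)) = 1) then (1 : ℂ) else 0) -
          ((((fixedModulus σ hσc c₀ hc₀)⁻¹ : ℝ≥0) : ℝ) : ℂ) *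
            (if (∀ a : fixedPart σ, normAbs E (a : E) ≤ ρ → ψ ((a : E) * ((a' : E) * (c₀ : E)⁻¹ - 1)) = 1) then (1 : ℂ) else 0))) * Dbar (a' : E) ∂μp =
      ((μp.real {a : fixedPart σ | normAbs E (a : E) ≤ ρ} : ℝ) : ℂ) *
        ((μp.real {t : fixedPart σ | ∀ a : fixedPart σ, normAbs E (a : E) ≤ ρ → ψ ((a : E) * (t : E)) = 1} : ℝ) : ℂ) * (1 - Dbar (c₀ : E)) := by
  haveI := locallyCompactSpace_fixedPart σ hσc
  have hm := fixedModulus_pos σ hσc c₀ hc₀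
  set 𝔞 : Set (fixedPart σ) := {t : fixedPart σ | ∀ a : fixedPart σ, normAbs E (a : E) ≤ ρ → ψ ((a : E) * (t : E)) = 1} with h𝔞
  have h𝔞m : MeasurableSet 𝔞 := measurableSet_ann σ ψ hψc ρ
  have h𝔞fin : μp 𝔞 < ⊤ := by
    refine lt_of_le_of_lt (measure_mono fun t ht => ?_)
      ((isClosed_fixedPart σ hσc).isClosedEmbedding_subtypeVal.isCompact_preimage (isCompact_setOf_normAbs_le (normAbs E a₁ / ρ))).measure_lt_top
    exact le_of_lt (ann_subset_ball σ ψ ha₁ hψa₁ hρ ht)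
  -- the two bump sets `S₁ = 1 + 𝔞`, `S₂ = c₀ (1 + 𝔞)`
  set S₁ : Set (fixedPart σ) := {a' : fixedPart σ | ∀ a : fixedPart σ, normAbs E (a : E) ≤ ρ → ψ ((a : E) * ((a' : E) - 1)) = 1} with hS₁
  set S₂ : Set (fixedPart σ) := {a' : fixedPart σ | ∀ a : fixedPart σ, normAbs E (a : E) ≤ ρ → ψ ((a : E) * ((a' : E) * (c₀ : E)⁻¹ - 1)) = 1} with hS₂
  have hone : σ (1 : E) = 1 := map_one σ
  have hS₁eq : S₁ = (fun a' : fixedPart σ => (-(⟨1, hone⟩ : fixedPart σ)) + a') ⁻¹' 𝔞 := by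
    ext a'
    simp only [hS₁, h𝔞, Set.mem_setOf_eq, Set.mem_preimage, AddSubgroup.coe_add, AddSubgroup.coe_neg]
    have : -(1 : E) + (a' : E) = (a' : E) - 1 := by ring
    simp_rw [this]
  have hS₂eq : (smulFixed σ c₀ hc₀) ⁻¹' S₂ = S₁ := by
    ext b
    simp only [hS₁, hS₂, Set.mem_setOf_eq, Set.mem_preimage, coe_smulFixed]
    have : (c₀ : E) * (b : E) * (c₀ : E)⁻¹ - 1 = (b : E) - 1 := by field_simp
    simp_rw [this]
  have hS₁m : MeasurableSet S₁ := by rw [hS₁eq]; exact h𝔞m.preimage (continuous_const.add continuous_id).measurable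
  have hS₂m : MeasurableSet S₂ := by
    have : S₂ = (smulFixed σ c₀ hc₀).symm ⁻¹' S₁ := by
      rw [← hS₂eq, ← Set.preimage_comp]
      ext x; simp
    rw [this]; exact hS₁m.preimage (smulFixed σ c₀ hc₀).symm.continuous.measurable
  have hμS₁ : μp S₁ = μp 𝔞 := by rw [hS₁eq]; exact measure_preimage_add μp _ _
  have hμS₂ : μp S₂ = fixedModulus σ hσc c₀ hc₀ * μp 𝔞 := by
    have h := measure_preimage_smulFixed σ hσc μp c₀ hc₀ hS₂m
    rw [hS₂eq, hμS₁] at h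
    calc μp S₂ = (fixedModulus σ hσc c₀ hc₀ : ℝ≥0∞) * (((fixedModulus σ hσc c₀ hc₀)⁻¹ : ℝ≥0) * μp S₂) := by
          rw [← mul_assoc, ← ENNReal.coe_mul, mul_inv_cancel₀ hm.ne', ENNReal.coe_one, one_mul]
      _ = fixedModulus σ hσc c₀ hc₀ * μp 𝔞 := by rw [← h]
  have hS₁fin : μp S₁ < ⊤ := by rw [hμS₁]; exact h𝔞fin
  have hS₂fin : μp S₂ < ⊤ := by rw [hμS₂]; exact ENNReal.mul_lt_top ENNReal.coe_lt_top h𝔞fin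
  -- `D̄` on the two bumps
  have hD_S₁ : ∀ a' ∈ S₁, Dbar (a' : E) = 1 := by
    intro a' ha'
    have hfix : σ ((a' : E) - 1) = (a' : E) - 1 := by rw [map_sub, map_one, show σ (a' : E) = a' from a'.2]
    have hsmall : normAbs E ((a' : E) - 1) < normAbs E a₁ / ρ :=
      normAbs_lt_of_forall_fixed_addChar_mul_eq_one σ ψ ha₁ hψa₁ hρ hfix fun a ha hle => ha' ⟨a, ha⟩ hle
    have h1 := hD1 _ (le_trans hsmall.le hρr)
    rwa [add_sub_cancel] at h1
  have hD_S₂ : ∀ a' ∈ S₂, Dbar (a' : E) = Dbar (c₀ : E) := by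
    intro a' ha'
    have hfix : σ ((a' : E) * (c₀ : E)⁻¹ - 1) = (a' : E) * (c₀ : E)⁻¹ - 1 := by
      rw [map_sub, map_one, map_mul, map_inv₀, hc₀, show σ (a' : E) = a' from a'.2]
    have hsmall : normAbs E ((a' : E) * (c₀ : E)⁻¹ - 1) < normAbs E a₁ / ρ :=
      normAbs_lt_of_forall_fixed_addChar_mul_eq_one σ ψ ha₁ hψa₁ hρ hfix fun a ha hle => ha' ⟨a, ha⟩ hle
    have h1 := hD1 _ (le_trans hsmall.le hρr)
    have heq : (c₀ : E) * (1 + ((a' : E) * (c₀ : E)⁻¹ - 1)) = (a' : E) := by rw [add_sub_cancel, mul_comm, inv_mul_cancel_right₀ c₀.ne_zero]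
    rw [← heq, hDmul, h1, mul_one]
  -- pointwise: the integrand is `μB · (𝟙_{S₁} D̄ − χ⁺(c₀)⁻¹ 𝟙_{S₂} D̄)`
  have hC : 0 ≤ C := le_trans (norm_nonneg _) (hDb 0)
  have hpt : ∀ a' : fixedPart σ, (((μp.real {a : fixedPart σ | normAbs E (a : E) ≤ ρ} : ℝ) : ℂ) *
        ((if (∀ a : fixedPart σ, normAbs E (a : E) ≤ ρ → ψ ((a : E) * ((a' : E) - 1)) = 1) then (1 : ℂ) else 0) -
          ((((fixedModulus σ hσc c₀ hc₀)⁻¹ : ℝ≥0) : ℝ) : ℂ) *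
            (if (∀ a : fixedPart σ, normAbs E (a : E) ≤ ρ → ψ ((a : E) * ((a' : E) * (c₀ : E)⁻¹ - 1)) = 1) then (1 : ℂ) else 0))) * Dbar (a' : E) =
      ((μp.real {a : fixedPart σ | normAbs E (a : E) ≤ ρ} : ℝ) : ℂ) *
        (S₁.indicator (fun a' : fixedPart σ => Dbar (a' : E)) a' - ((((fixedModulus σ hσc c₀ hc₀)⁻¹ : ℝ≥0) : ℝ) : ℂ) * S₂.indicator (fun a' : fixedPart σ => Dbar (a' : E)) a') := by
    intro a'
    by_cases h1 : ∀ a : fixedPart σ, normAbs E (a : E) ≤ ρ → ψ ((a : E) * ((a' : E) - 1)) = 1 <;>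
      by_cases h2 : ∀ a : fixedPart σ, normAbs E (a : E) ≤ ρ → ψ ((a : E) * ((a' : E) * (c₀ : E)⁻¹ - 1)) = 1
    · rw [if_pos h1, if_pos h2, Set.indicator_of_mem (show a' ∈ S₁ from h1), Set.indicator_of_mem (show a' ∈ S₂ from h2)]; ring
    · rw [if_pos h1, if_neg h2, Set.indicator_of_mem (show a' ∈ S₁ from h1), Set.indicator_of_notMem (show a' ∉ S₂ from h2)]; ring
    · rw [if_neg h1, if_pos h2, Set.indicator_of_notMem (show a' ∉ S₁ from h1), Set.indicator_of_mem (show a' ∈ S₂ from h2)]; ring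
    · rw [if_neg h1, if_neg h2, Set.indicator_of_notMem (show a' ∉ S₁ from h1), Set.indicator_of_notMem (show a' ∉ S₂ from h2)]; ring
  have hi₁ : Integrable (S₁.indicator (fun a' : fixedPart σ => Dbar (a' : E))) μp :=
    (integrable_indicator_iff hS₁m).2 (Measure.integrableOn_of_bounded hS₁fin.ne (hDm.comp measurable_subtype_coe).aestronglyMeasurable
      (Eventually.of_forall fun a' => hDb _))
  have hi₂ : Integrable (S₂.indicator (fun a' : fixedPart σ => Dbar (a' : E))) μp :=
    (integrable_indicator_iff hS₂m).2 (Measure.integrableOn_of_bounded hS₂fin.ne (hDm.comp measurable_subtype_coe).aestronglyMeasurable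
      (Eventually.of_forall fun a' => hDb _))
  have hI₁ : ∫ a', S₁.indicator (fun a' : fixedPart σ => Dbar (a' : E)) a' ∂μp = ((μp.real 𝔞 : ℝ) : ℂ) := by
    have hpt₁ : S₁.indicator (fun a' : fixedPart σ => Dbar (a' : E)) = S₁.indicator (fun _ => (1 : ℂ)) := by
      funext a'
      by_cases h : a' ∈ S₁
      · rw [Set.indicator_of_mem h, Set.indicator_of_mem h, hD_S₁ a' h]
      · rw [Set.indicator_of_notMem h, Set.indicator_of_notMem h]
    rw [hpt₁, integral_indicator_const _ hS₁m, Complex.real_smul, mul_one, measureReal_def, hμS₁, ← measureReal_def]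
  have hI₂ : ∫ a', S₂.indicator (fun a' : fixedPart σ => Dbar (a' : E)) a' ∂μp = (((fixedModulus σ hσc c₀ hc₀ : ℝ≥0) : ℝ) : ℂ) * ((μp.real 𝔞 : ℝ) : ℂ) * Dbar (c₀ : E) := by
    have hpt₂ : S₂.indicator (fun a' : fixedPart σ => Dbar (a' : E)) = S₂.indicator (fun _ => Dbar (c₀ : E)) := by
      funext a'
      by_cases h : a' ∈ S₂
      · rw [Set.indicator_of_mem h, Set.indicator_of_mem h, hD_S₂ a' h]
      · rw [Set.indicator_of_notMem h, Set.indicator_of_notMem h]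
    rw [hpt₂, integral_indicator_const _ hS₂m, Complex.real_smul, measureReal_def, hμS₂, ENNReal.toReal_mul, ENNReal.coe_toReal, ← measureReal_def]
    push_cast; ring
  rw [integral_congr_ae (Eventually.of_forall hpt), integral_const_mul, integral_sub hi₁ (hi₂.const_mul _), integral_const_mul, hI₁, hI₂]
  have hm' : (((fixedModulus σ hσc c₀ hc₀ : ℝ≥0) : ℝ) : ℂ) ≠ 0 := by exact_mod_cast hm.ne'
  have hinv : ((((fixedModulus σ hσc c₀ hc₀)⁻¹ : ℝ≥0) : ℝ) : ℂ) * (((fixedModulus σ hσc c₀ hc₀ : ℝ≥0) : ℝ) : ℂ) = 1 := by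
    rw [NNReal.coe_inv, Complex.ofReal_inv, inv_mul_cancel₀ hm']
  linear_combination (-(((μp.real {a : fixedPart σ | normAbs E (a : E) ≤ ρ} : ℝ) : ℂ) * ((μp.real 𝔞 : ℝ) : ℂ) * Dbar (c₀ : E))) * hinv

end Pairing

end Summit.HodgeConjecture.HodgeConjecture.Cruxes.H413.K2E3TwoBumpTransform

end
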